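import Summits.ABC.IUTFork.Repair.RHCellWeightsCreditScreen
import HarnessLib

/-!
# R-H ROUND 3, SCREEN RULE S1 — SHARP TAIL FORM: an `O(j)` credit above the slice keeps at most `S(J) + a·(T(l⋇) − T(J)) + b·(l⋇ − J)`;
# for the HARMONIC profile the kept share is `3J(n+1)/((n−1)(2n+5)) − J(J²+5)/(n(n−1)(2n+5)) → (3/2)f − (1/2)f³` — B24's `μ₄ + π₄` EXACTLY in the limit

abc-iut cell, rung LADDER-ABC:A2.RESCUE.H; R-H seat abc-iut-rh2-w-1 (GEN 2; Q1′ WEIGHTS typer, kernel side); sequel of `Repair/RHCellWeightsCreditScreen.lean`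
(p485470, rh3-ref-1 SIGN PASS 2026-08-27T02:05:40Z). PROOF-ONLY (0 definitions, 0 `Prop` facts). rh3-ref-1's countersign noted the one-sided SLACK of p485470's
bound against abc-iut-rh2-tab-2's signed (C-ii) law: «tab-2's exact integrated values are `μ₄ ≈ f³` and `π₄ = 1.5·f·(1 − f²)`, so `μ₄ + π₄ = 1.5 f − 0.5 f³`; the
theorem's kept share `→ f³ + 1.5 f` is an UPPER BOUND of it (slack `1.5 f³`, from bounding the harmonic credit `(J/j)(j²−1)` by `J·j` and summing the price over
ALL labels)». This file removes the second source of slack: the price is summed over the TAIL `j > J` only (`Σ_{J<j≤n} (a·j + b) = a·(T(n) − T(J)) + b·(n − J)`,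
`sum_fin_linear_tail`), giving `placeSum_credit_le_of_linear_tail` (no sign condition on `a, b` needed) and, for the harmonic profile (`a = J`, `b = 0`), the kept
numerator `S(J) + J·(T(n) − T(J)) = J·T(n) − J(J²+5)/6` (`harmonicKept_tail_eq`) and share **`3J(n+1)/((n−1)(2n+5)) − J(J²+5)/(n(n−1)(2n+5))`**
(`harmonicKeptFrac_tail_eq`) `→ (3/2)f − (1/2)f³` — B24's `μ₄ + π₄` EXACTLY in the limit (the remaining slack is only `(J/j)(j²−1) ≤ J·j`, i.e. `J·Σ_{j>J} 1/j =
O(f·log(1/f)/n)`). At the bed (any DH pilot datum, realising ideles; uniform `J, a, b`): **`K(ω) ≤ ((S(J) + a·(T(l⋇) − T(J)) + b·(l⋇ − J))/S(l⋇))·M`**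
(`keptMass_settingPrVolSharp_le_tailFrac_mul_totalTrivialMass`). Everything else (the `θ·j²` law, the datum necessity in `OffSigmaTolerance` currency) is in the
companions, cited not restated.
HONEST FRAMING: arithmetic about OUR typed weights; `ω` is a HYPOTHESIS SHAPE (a candidate's claimed credit), never asserted; nothing here asserts that abc is proved
or refuted, or that [IUTchIII] Cor. 3.12 holds or fails at any datum, or takes a side on any author; typed ≠ proved; computed ≠ proved.
[claim: Mochizuki2012, status: disputed] for every IUT locution. [cite: Mochizuki2012, IUTchIII Cor. 3.12 p. 173–174, Prop. 3.9 (i)–(iii) p. 116–117;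
IUTchIV Thm. 1.10 Step (v) p. 27–29] [cite: DupuyHilado2025, §3.3, Thm. 3.10.1]
-/

noncomputable section

open Set Function NumberField IsDedekindDomain

namespace Summit.ABC.IUTFork.Repair.RH.CellWeights

open Summit.ABC.IUTFork.Thm311 Summit.ABC.IUTFork.Thm311.Real Summit.ABC.IUTFork.Cor312 Summit.ABC.IUTFork.Cor312.Setting
  Summit.ABC.IUTFork.Cor312Vol Summit.ABC.IUTFork.Cor312Prov Literature.IUT.LogThetaLattice Literature.IUT.LogVolume
  Literature.IUT.HodgeTheaters Literature.IUT.LogVolume.ThetaData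
  Summit.ABC.IUTFork.Repair.RH.SigmaLicence Summit.ABC.IUTFork.Repair.RH.SigmaStrataEq Summit.ABC.IUTFork.Repair.RH.SigmaMass

/-! ## §0. Label arithmetic on the TAIL `j > J` -/

section LabelArithmetic

/-- **The price of an `O(j)` credit over the TAIL only**: for `J ≤ n`, `Σ_{i<n, i+1>J} (a·(i+1) + b) = a·(T(n) − T(J)) + b·(n − J)`, `T(k) = k(k+1)/2` (written
with the labels `i+1 ≤ J` contributing `0`). [folklore] -/
theorem sum_fin_linear_tail {n J : ℕ} (hJ : J ≤ n) (a b : ℝ) :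
    ∑ i : Fin n, (if (i : ℕ) + 1 ≤ J then 0 else a * (((i : ℕ) : ℝ) + 1) + b) =
      a * ((n : ℝ) * (n + 1) / 2 - (J : ℝ) * (J + 1) / 2) + b * ((n : ℝ) - J) := by
  rw [Fin.sum_univ_eq_sum_range (fun i : ℕ => if i + 1 ≤ J then (0 : ℝ) else a * ((i : ℝ) + 1) + b) n,
    ← Finset.sum_range_add_sum_Ico _ hJ]
  have h1 : ∑ k ∈ Finset.range J, (if k + 1 ≤ J then (0 : ℝ) else a * ((k : ℝ) + 1) + b) = 0 :=
    Finset.sum_eq_zero fun k hk => by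
      rw [Finset.mem_range] at hk
      rw [if_pos (by omega)]
  have h2 : ∑ k ∈ Finset.Ico J n, (if k + 1 ≤ J then (0 : ℝ) else a * ((k : ℝ) + 1) + b) =
      ∑ k ∈ Finset.Ico J n, (a * ((k : ℝ) + 1) + b) :=
    Finset.sum_congr rfl fun k hk => by
      rw [Finset.mem_Ico] at hk
      rw [if_neg (by omega)]
  rw [h1, zero_add, h2, Finset.sum_Ico_eq_sub _ hJ, sum_range_linear, sum_range_linear]
  ring

/-- **HARMONIC KEPT NUMERATOR, tail form**: `S(J) + J·(T(n) − T(J)) = J·T(n) − J(J²+5)/6` (`S(J) − J·T(J) = −J(J²+5)/6`). [folklore] -/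
theorem harmonicKept_tail_eq (n J : ℝ) :
    J * (J - 1) * (2 * J + 5) / 6 + J * (n * (n + 1) / 2 - J * (J + 1) / 2) = J * (n * (n + 1) / 2) - J * (J ^ 2 + 5) / 6 := by
  ring

/-- **HARMONIC KEPT SHARE, tail form**: for `n ≥ 2`,
`(S(J) + J·(T(n) − T(J)))/S(n) = 3J(n+1)/((n−1)(2n+5)) − J(J²+5)/(n(n−1)(2n+5))` — with `f := J/n` this `→ (3/2)f − (1/2)f³`, abc-iut-rh2-tab-2's signed
`μ₄ + π₄ = 1.5 f − 0.5 f³` EXACTLY in the limit (rh3-ref-1 2026-08-27T02:05:40Z); so a HARMONIC-credit candidate keeps share `< 1` at EVERY `f < 1`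
(`(3/2)f − (1/2)f³ < 1 ⟺ (f−1)²(f+2) > 0`). [folklore] -/
theorem harmonicKeptFrac_tail_eq {n : ℕ} (hn : 2 ≤ n) (J : ℝ) :
    (J * (J - 1) * (2 * J + 5) / 6 + J * ((n : ℝ) * (n + 1) / 2 - J * (J + 1) / 2)) / ((n : ℝ) * (n - 1) * (2 * n + 5) / 6) =
      3 * J * ((n : ℝ) + 1) / (((n : ℝ) - 1) * (2 * n + 5)) - J * (J ^ 2 + 5) / ((n : ℝ) * ((n : ℝ) - 1) * (2 * n + 5)) := by
  have h2 : (2 : ℝ) ≤ n := by exact_mod_cast hn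
  have hn0 : (n : ℝ) ≠ 0 := by positivity
  have hn1 : (n : ℝ) - 1 ≠ 0 := by
    have : (0 : ℝ) < (n : ℝ) - 1 := by linarith
    exact this.ne'
  have hn5 : (2 * (n : ℝ) + 5) ≠ 0 := by positivity
  rw [harmonicKept_tail_eq]
  field_simp
  ring

/-- The limiting harmonic share is `< 1` off `f = 1`: `(3/2)f − (1/2)f³ < 1` for `0 ≤ f < 1` (`= 1 − (1−f)²(f+2)/2`). [folklore] -/
theorem harmonicLimitShare_lt_one {f : ℝ} (hf0 : 0 ≤ f) (hf1 : f < 1) : 3 / 2 * f - 1 / 2 * f ^ 3 < 1 := by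
  nlinarith [mul_pos (mul_pos (sub_pos.2 hf1) (sub_pos.2 hf1)) (show (0 : ℝ) < f + 2 by linarith)]

end LabelArithmetic

/-! ## §1. One packet: the TAIL form of the `O(j)` bound (no sign condition on `a, b`) -/

section Place

/-- **(S1-a, TAIL FORM) an `O(j)` credit keeps at most `S(J) + a·(T(n) − T(J)) + b·(n − J)`.** One packet, `n` labels, place weight `h ≥ 0`, slice `J ≤ n`,
profile `ω ≤ 1` with `ω_i·((i+1)²−1) ≤ a·(i+1) + b` for `i+1 > J` (ANY reals `a, b`): `Σ_i ω_i((i+1)²−1)h ≤ (S(J) + a·(T(n)−T(J)) + b·(n−J))·h` — the licence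
bound below the slice, the linear law on the tail only (sharpens p485470 `placeSum_credit_le_of_linear`, which summed the price over all labels). [folklore] -/
theorem placeSum_credit_le_of_linear_tail {n J : ℕ} (hJ : J ≤ n) (ω : Fin n → ℝ) (hω1 : ∀ i, ω i ≤ 1) {a b h : ℝ} (hh : 0 ≤ h)
    (hlin : ∀ i : Fin n, J < (i : ℕ) + 1 → ω i * ((((i : ℕ) : ℝ) + 1) ^ 2 - 1) ≤ a * (((i : ℕ) : ℝ) + 1) + b) :
    ∑ i : Fin n, ω i * (((((i : ℕ) : ℝ) + 1) ^ 2 - 1) * h) ≤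
      ((J : ℝ) * (J - 1) * (2 * J + 5) / 6 + a * ((n : ℝ) * (n + 1) / 2 - (J : ℝ) * (J + 1) / 2) + b * ((n : ℝ) - J)) * h := by
  have hterm : ∀ i : Fin n, ω i * (((((i : ℕ) : ℝ) + 1) ^ 2 - 1) * h) ≤
      ((if (i : ℕ) + 1 ≤ J then (((i : ℕ) : ℝ) + 1) ^ 2 - 1 else 0) +
        (if (i : ℕ) + 1 ≤ J then 0 else a * (((i : ℕ) : ℝ) + 1) + b)) * h := by
    intro i
    have hi0 : (0 : ℝ) ≤ (((i : ℕ) : ℝ) + 1) ^ 2 - 1 := by nlinarith [(Nat.cast_nonneg (i : ℕ) : (0 : ℝ) ≤ (i : ℕ))]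
    rw [← mul_assoc]
    refine mul_le_mul_of_nonneg_right ?_ hh
    by_cases hiJ : (i : ℕ) + 1 ≤ J
    · rw [if_pos hiJ, if_pos hiJ, add_zero]
      nlinarith [mul_nonneg (sub_nonneg.2 (hω1 i)) hi0]
    · rw [if_neg hiJ, if_neg hiJ, zero_add]
      exact hlin i (by omega)
  refine (Finset.sum_le_sum fun i _ => hterm i).trans (le_of_eq ?_)
  rw [← Finset.sum_mul, Finset.sum_add_distrib, sum_fin_sqSubOne_initialSegment hJ, sum_fin_linear_tail hJ]
  ring

end Place

/-! ## §2. At the bed `settingPrVolSharp X`: the tail form of the uniform fraction bound -/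

section Bed

variable {F : Type} [Field F] [NumberField F] (X : PilotData F) {logv : PadicLogs F} (hlog : LogvAnalytic logv)
  (M : Type) [Field M] [NumberField M]
  (archPk : ∀ (j : (thetaIndex X).Label) (vQ : (thetaIndex X).VQ), Set ((logShellsDH X logv).Packet j vQ))
  (archSub : ∀ (j : (thetaIndex X).Label) (v : (thetaIndex X).V),
    Set ((logShellsDH X logv).Packet j ((thetaIndex X).over v)))
  (Ψ : ℤ → ∀ v : (thetaIndex X).V, v ∈ (thetaIndex X).Vbad → Set ((logShellsDH X logv).StarPacket v))
  (act : ℤ → ∀ v : (thetaIndex X).V, v ∈ (thetaIndex X).Vbad →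
    (logShellsDH X logv).StarPacket v → Module.End ℚ ((logShellsDH X logv).StarPacket v))
  (Mmod : ℤ → ∀ j : (thetaIndex X).LabelStar, Set ((logShellsDH X logv).GlobalPacket j.1))
  (region : ℤ → ∀ j : (thetaIndex X).LabelStar, FinDivisor M → ∀ vQ : (thetaIndex X).VQ,
    Set ((logShellsDH X logv).Packet j.1 vQ))
  (n : ℤ) {HT : Type} {LogLink : HT → HT → Type} {IsFull : ∀ {s t : HT}, LogLink s t → Prop}
  (lat : LGPGaussianLogThetaLattice LogLink IsFull)
  {Frd : Type} {IsoF : Frd → Frd → Type} {Ob : Frd → Type} {realify : Frd → Frd} {Strip : Type}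
  {IsoS : Strip → Strip → Type} {Mv : ∀ v : (thetaIndex X).V, v ∈ (thetaIndex X).Vbad → Type}
  [∀ v h, Monoid (Mv v h)]
  (sig : GlobalLGPFrobenioidSignature (thetaIndex X).lstar (thetaIndex X).V (· ∈ (thetaIndex X).Vbad)
    Frd IsoF Ob realify Strip IsoS Mv)
  (split : SplittingMonoids Mv) {ObΔ : Type} {N : ∀ v : (thetaIndex X).V, v ∈ (thetaIndex X).Vbad → Type}
  [∀ v h, Monoid (N v h)] (qData : QPilotData ObΔ N)
  (tq : ∀ (pp : Nat.Primes) (x : (thetaIndex X).Fibre (.inr pp)), haveI : Fact (pp : ℕ).Prime := ⟨pp.2⟩; kOf X pp.1 x)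
  (t : ∀ (pp : Nat.Primes) (_ : Fin X.lstar) (x : (thetaIndex X).Fibre (.inr pp)),
    haveI : Fact (pp : ℕ).Prime := ⟨pp.2⟩; kOf X pp.1 x)
  (htq0 : ∀ pp x, tq pp x ≠ 0)
  (htq1 : ∀ (pp : Nat.Primes) (x : (thetaIndex X).Fibre (.inr pp)),
    haveI : Fact (pp : ℕ).Prime := ⟨pp.2⟩; placeOf X pp.1 x ∉ X.S → ‖tq pp x‖ = 1)
  (ht0 : ∀ pp i x, t pp i x ≠ 0)
  (ht : ∀ (pp : Nat.Primes) (i : Fin X.lstar) (x : (thetaIndex X).Fibre (.inr pp)),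
    haveI : Fact (pp : ℕ).Prime := ⟨pp.2⟩
    Real.log ‖t pp i x‖ = -(X.thetaPilot i (placeOf X pp.1 x)) * logNorm F (placeOf X pp.1 x) / localDegree F (placeOf X pp.1 x))
  (htq : ∀ (pp : Nat.Primes) (x : (thetaIndex X).Fibre (.inr pp)),
    haveI : Fact (pp : ℕ).Prime := ⟨pp.2⟩
    Real.log ‖tq pp x‖ = -(X.qPilot (placeOf X pp.1 x)) * logNorm F (placeOf X pp.1 x) / localDegree F (placeOf X pp.1 x))

include ht0 ht htq in
/-- **(S1-a, TAIL FORM) AT THE BED: `K(ω) ≤ ((S(J) + a·(T(l⋇) − T(J)) + b·(l⋇ − J))/S(l⋇))·M`** for `ω ≤ 1` with a UNIFORM `O(j)` law above the slice `J ≤ l⋇`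
(any reals `a, b`), realising ideles; `K(ω) = PN Σᶠ ω·cost` (= abc-iut-rh2-q2-eq's `weightedTrivialMass P (1−ω)`), `M` the total trivial mass (`= T.gap` at a genuine
datum, p478601). Harmonic profile: share `≤ 3J(l⋇+1)/((l⋇−1)(2l⋇+5)) − J(J²+5)/(l⋇(l⋇−1)(2l⋇+5)) → (3/2)f − (1/2)f³` (`harmonicKeptFrac_tail_eq`).
[claim: Mochizuki2012, status: disputed] -/
theorem keptMass_settingPrVolSharp_le_tailFrac_mul_totalTrivialMass
    (ω : Fin (thetaIndex X).lstar × (thetaIndex X).VQ → ℝ) (hω1 : ∀ c, ω c ≤ 1)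
    {J : ℕ} (hJ : J ≤ X.lstar) {a b : ℝ}
    (hlin : ∀ (i : Fin (thetaIndex X).lstar) (vQ : (thetaIndex X).VQ), J < (i : ℕ) + 1 →
      ω (i, vQ) * ((((i : ℕ) : ℝ) + 1) ^ 2 - 1) ≤ a * (((i : ℕ) : ℝ) + 1) + b) :
    processionNormalized (fun i : Fin (thetaIndex X).lstar => ∑ᶠ vQ : (thetaIndex X).VQ,
        ω (i, vQ) * cellTrivialCost (settingPrVolSharp X hlog M archPk archSub Ψ act Mmod region n lat sig split qData tq t htq0 htq1) (i, vQ)) ≤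
      ((J : ℝ) * (J - 1) * (2 * J + 5) / 6 + a * ((X.lstar : ℝ) * (X.lstar + 1) / 2 - (J : ℝ) * (J + 1) / 2) + b * ((X.lstar : ℝ) - J)) /
          ((X.lstar : ℝ) * (X.lstar - 1) * (2 * X.lstar + 5) / 6) *
        totalTrivialMass (settingPrVolSharp X hlog M archPk archSub Ψ act Mmod region n lat sig split qData tq t htq0 htq1) := by
  have hcost := cellTrivialCost_settingPrVolSharp_eq_sqSubOne_mul_placeWeight X hlog M archPk archSub Ψ act Mmod region n lat sig split qData tq t
    htq0 htq1 ht0 ht htq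
  have hhfin := placeWeight_support_finite X hlog M archPk archSub Ψ act Mmod region n lat sig split qData tq t htq0 htq1 htq
  have hsupp : ∀ i : Fin (thetaIndex X).lstar, (Function.support fun vQ : (thetaIndex X).VQ =>
      ω (i, vQ) * cellTrivialCost (settingPrVolSharp X hlog M archPk archSub Ψ act Mmod region n lat sig split qData tq t htq0 htq1) (i, vQ)).Finite :=
    fun i => hhfin.subset (Function.support_subset_iff'.2 fun vQ hvQ => by
      rw [hcost i vQ, Function.notMem_support.1 hvQ, mul_zero, mul_zero])
  -- Step 1: the place-sum bound `K(ω) ≤ (C·Σᶠ h)/l⋇`, `C` the tail numerator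
  have hK : processionNormalized (fun i : Fin (thetaIndex X).lstar => ∑ᶠ vQ : (thetaIndex X).VQ,
        ω (i, vQ) * cellTrivialCost (settingPrVolSharp X hlog M archPk archSub Ψ act Mmod region n lat sig split qData tq t htq0 htq1) (i, vQ)) ≤
      ((J : ℝ) * (J - 1) * (2 * J + 5) / 6 + a * ((X.lstar : ℝ) * (X.lstar + 1) / 2 - (J : ℝ) * (J + 1) / 2) + b * ((X.lstar : ℝ) - J)) *
        (∑ᶠ vQ : (thetaIndex X).VQ, Sum.elim (fun _ : Unit => (0 : ℝ))
          (fun pp : Nat.Primes => (∑ v ∈ placesOver F pp, X.qPilot v * logNorm F v) / Module.finrank ℚ F) vQ) / X.lstar := by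
    unfold processionNormalized
    rw [sum_finsum_comm Finset.univ (fun (i : Fin (thetaIndex X).lstar) (vQ : (thetaIndex X).VQ) =>
        ω (i, vQ) * cellTrivialCost (settingPrVolSharp X hlog M archPk archSub Ψ act Mmod region n lat sig split qData tq t htq0 htq1) (i, vQ))
      fun i _ => hsupp i, mul_finsum]
    refine div_le_div_of_nonneg_right ?_ (Nat.cast_nonneg _)
    have hF : (Function.support fun vQ : (thetaIndex X).VQ => ∑ i : Fin (thetaIndex X).lstar,
        ω (i, vQ) * cellTrivialCost (settingPrVolSharp X hlog M archPk archSub Ψ act Mmod region n lat sig split qData tq t htq0 htq1) (i, vQ)).Finite :=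
      hhfin.subset (Function.support_subset_iff'.2 fun vQ hvQ => Finset.sum_eq_zero fun i _ => by
        rw [hcost i vQ, Function.notMem_support.1 hvQ, mul_zero, mul_zero])
    have hG : (Function.support fun vQ : (thetaIndex X).VQ =>
        ((J : ℝ) * (J - 1) * (2 * J + 5) / 6 + a * ((X.lstar : ℝ) * (X.lstar + 1) / 2 - (J : ℝ) * (J + 1) / 2) + b * ((X.lstar : ℝ) - J)) *
          Sum.elim (fun _ : Unit => (0 : ℝ))
            (fun pp : Nat.Primes => (∑ v ∈ placesOver F pp, X.qPilot v * logNorm F v) / Module.finrank ℚ F) vQ).Finite :=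
      hhfin.subset (Function.support_subset_iff'.2 fun vQ hvQ => by rw [Function.notMem_support.1 hvQ, mul_zero])
    refine finsum_le_finsum' hF hG fun vQ => ?_
    simp only [hcost]
    exact placeSum_credit_le_of_linear_tail (hJ.trans_eq rfl) (fun i => ω (i, vQ)) (fun i => hω1 _) (placeWeight_nonneg X vQ)
      (fun i hi => hlin i vQ hi)
  -- Step 2: divide by `M = (S(l⋇)/l⋇)·Σᶠ h`
  rw [totalTrivialMass_settingPrVolSharp_eq_sqSubOneSum_mul_finsum_placeWeight X hlog M archPk archSub Ψ act Mmod region n lat sig split qData tq t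
    htq0 htq1 ht0 ht htq]
  have h2 : (2 : ℝ) ≤ X.lstar := by exact_mod_cast X.two_le_lstar
  have hl0 : (X.lstar : ℝ) ≠ 0 := by positivity
  have hl1 : (X.lstar : ℝ) - 1 ≠ 0 := (show (0 : ℝ) < X.lstar - 1 by linarith).ne'
  have hl5 : 2 * (X.lstar : ℝ) + 5 ≠ 0 := by positivity
  refine hK.trans (le_of_eq ?_)
  field_simp

end Bed

end Summit.ABC.IUTFork.Repair.RH.CellWeights

end
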